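import Summits.BirchSwinnertonDyer.BirchSwinnertonDyer.Theorems.ErratumRoadFiveNonSurjCornerKolyJProp44PairSelmer
import Summits.BirchSwinnertonDyer.BirchSwinnertonDyer.Theorems.KatoDescentTamePotSupersingularJetchevIrreducibleProp44AHalfRows
import Summits.BirchSwinnertonDyer.BirchSwinnertonDyer.Theorems.Rank1ResidualJetRingClassFields
import Literature.NumberTheory.EllipticCurves.GrossLMS1991.HeegnerEulerSystemCongruenceImageFree
import HarnessLib

/-!
# Crux `JetchevIrreducibleReadingByName` (item 20165, shared K8-t′ / K9), stub S5: the PRIMED (B)-ONLY reading of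
# [McC] Prop. 4.4 / [J] Prop. 4.7 — guarded `ℓ ≠ 2` — IS A THEOREM modulo ONE published fact, Gross 1991 Prop. 3.7 (2)
# (`GrossLMS1991.prop37_2_frobeniusCongruence`) — seat `bsd-potss-k8t-c4` g11; `--supports 20165`, helper; route-free;
# CONDITIONAL on that named fact (a `conditional-result`); nothing booked, no item closed, BSD is not proved by any of this

WHY. The S5 lane of crux 20165 (this seat g10/g11): the registered stub `Sig.stub_prop44Irred` ([McC] Prop. 4.4 read
irreducible, `(A) ∧ (B)`, all odd `p`) was re-keyed to `h47P` = primed (`p ∣ N_E`) + (B)-only (chain p534645 … p538852).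
Three cells met on the (B)-conjunct today: (i) cell `bsd-stepL` (seat corner-p1 g9/g10) re-keyed x11b3's `h44` programme
from Gross primes to ZHANG primes and landed the PAIR END `Prop44.zsmul_kolyvaginClass_mem_selmerLocalKer_iff_of_compat`
(p539541): for two COMPATIBLE concrete data at `(mℓ, m)` — compatibility clauses = S5's binders verbatim — the composite
order form `p^a c_M(mℓ) ∈ Sel_λ ↔ p^a c_M(m) ∈ Ker_λ`, modulo (γ) at the pair and the standing inputs `hA`/`hPt`;
(ii) cell `bsd-stepL`'s literature seat (lit g24) typed (γ) = Gross 1991 Prop. 3.7 (2) as the image-free named fact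
`GrossLMS1991.prop37_2_frobeniusCongruence` (p534286) with the END-currency corollary `.reductionCongruence` (p535266),
printed for `ℓ ≠ 2` (Nekovář 2007 Prop. 4.9/4.13 (ii)); (iii) this seat's g10 (A)-half and `hA`/`hPt` dischargers for
`E[p]` irreducible, `p ∣ N_E`, Heegner (p530898). Composing: `(A)⁻¹ ∘ (pair END)` is (B). The guard `ℓ ≠ 2` is the
print boundary: a Zhang–Kolyvagin prime `ℓ = 2` forces `p ∣ 3`, i.e. `p = 3` (with `a₂ = 0`, `2 ∤ N`, `2` inert) —
outside both printed sources; the H63 machine chooses its Kolyvagin primes by Čebotarev and can always avoid `ℓ = 2`,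
so the chain is re-keyed once more to `h47P2` := `h47P` + `l ≠ 2` (files `…PB2`), and the planner's v7 cut can take
S5 ↦ `stub_prop47IrredP2` := `h47P2` — which THIS FILE PROVES modulo the named fact.

WHAT IS PROVED. `h47P2_of_prop37_2` : `GrossLMS1991.prop37_2_frobeniusCongruence → h47P2` (the closed statement:
for `W` [non-CM], `K` Heegner with `d_K ∉ {−3,−4}`, odd `p`, `E[p]` irreducible, `p ∣ N_E`, `Dt β ι`, `M ≥ 1`,
square-free `mℓ` with `ℓ ≠ 2` prime, `ℓ ∤ m`, all prime factors Zhang–Kolyvagin of index `≥ M`, COMPATIBLE data `d` at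
`m` and `d'` at `mℓ`, the place `λ ∋ ℓ`, every `j`: `p^j•c_M(d') ∈ Ker_λ ↔ p^j•c_M(d) ∈ Ker_λ`). HONEST FRAMING:
CONDITIONAL on the displayed published fact (Gross 3.7 (2) / Nekovář 4.13 (ii), Eichler–Shimura; unformalised);
nothing asserted about any curve; the crux and BSD stay open; no stub of the registered skeleton v6 is closed by this
(v6's S5 text is the unprimed `(A) ∧ (B)` reading; the planner decides the re-cut).

References: [cite: McCallumLMS1991, §4 Prop. 4.4, Lemma 4.3, (4)–(6)] [cite: GrossLMS1991, Prop. 3.7 (2) (p. 240), Prop. 3.6,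
§4 (4.1), Prop. 6.2 (2)] [cite: Nekovar2007, Prop. 4.9, Prop. 4.13 (ii)] [cite: Jetchev2008, Prop. 4.4, Prop. 4.7, Rem. 6.2]
[cite: WZhang2014, Notations (xii)].
-/

set_option autoImplicit false
-- the Theorems directory repeats the summit name (sibling precedent `KatoDescentPotSupersingularAssembly.lean`)
set_option linter.dupNamespace false

noncomputable section

open scoped Classical Pointwise

open WeierstrassCurve NumberField IsDedekindDomain Field
  Literature.NumberTheory.GaloisRepresentations Literature.NumberTheory.EllipticCurves
  Literature.NumberTheory.EllipticCurves.KolyvaginCocycle Literature.NumberTheory.EllipticCurves.ModularForms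
  Summit.BirchSwinnertonDyer.Rank1Residual Summit.BirchSwinnertonDyer.Rank1Residual.X11b
  Summit.BirchSwinnertonDyer.Rank1Residual.X11b.Three

namespace Summit.BirchSwinnertonDyer.BirchSwinnertonDyer.Theorems.JetchevIrreducibleProp44

/-- **S5′ (primed, (B)-only, `ℓ ≠ 2`) from Gross 1991 Prop. 3.7 (2).** For compatible data `(d, d')` at `(m, mℓ)`:
corner-p1's pair END (p539541) gives `p^j c(d') ∈ Sel_λ ↔ p^j c(d) ∈ Ker_λ` — its (γ) binder fed by the fact's
`reductionCongruence` (`ℓ ≠ 2`), its `hA`/`hPt` binders by this seat's irreducible dischargers (p530898) — and the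
(A)-half (p530898) turns `Sel_λ` into `Ker_λ` for the class at `mℓ`. CONDITIONAL on the named fact.
[cite: McCallumLMS1991, §4 Prop. 4.4] [cite: GrossLMS1991, Prop. 3.7 (2)] [cite: Nekovar2007, Prop. 4.13 (ii)]
[cite: Jetchev2008, Prop. 4.7] -/
theorem h47P2_of_prop37_2 (h37 : GrossLMS1991.prop37_2_frobeniusCongruence) :
    ∀ (W : WeierstrassCurve ℚ) [W.IsElliptic] [W.IsGloballyMinimal] [NeZero (W.conductorNorm ℤ)],
        ¬ W.HasCM →
        ∀ (K : Type) [Field K] [NumberField K], IsImaginaryQuadratic K →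
        NumberField.discr K ≠ -3 → NumberField.discr K ≠ -4 →
        SatisfiesHeegnerHypothesis (W.conductorNorm ℤ) K →
        ∀ (p : ℕ) [Fact p.Prime], p ≠ 2 → W.HasIrreducibleModPGaloisRep p → (p : ℤ) ∣ W.conductorNorm ℤ →
        ∀ (Dt : ModularParametrizationData W (W.conductorNorm ℤ)) (β : ℤ) (ι : K →+* ℂ)
          (M : ℕ), 1 ≤ M →
        ∀ (m l : ℕ), Squarefree (m * l) → l.Prime → l ≠ 2 → ¬ l ∣ m →
          (∀ l' ∈ (m * l).primeFactors, Zhang2014.IsKolyvaginPrime (W.conductorNorm ℤ) W K p l' ∧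
            M ≤ Zhang2014.kolyvaginIndex W p l') →
        ∀ (d : KolyvaginHeegnerData Dt β ι m) (d' : KolyvaginHeegnerData Dt β ι (m * l)),
          (∀ l' ∈ m.primeFactors, ∀ (x : ringClassField K ι m) (x' : ringClassField K ι (m * l)),
            (x : ℂ) = x' → ((d'.σ l' x' : ringClassField K ι (m * l)) : ℂ) = (d.σ l' x : ℂ)) →
          (∀ s ∈ d.S, ∃ s' ∈ d'.S, ∀ (x : ringClassField K ι m) (x' : ringClassField K ι (m * l)),
            (x : ℂ) = x' → ((s' x' : ringClassField K ι (m * l)) : ℂ) = (s x : ℂ)) →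
          (∀ s' ∈ d'.S, ∃ s ∈ d.S, ∀ (x : ringClassField K ι m) (x' : ringClassField K ι (m * l)),
            (x : ℂ) = x' → ((s' x' : ringClassField K ι (m * l)) : ℂ) = (s x : ℂ)) →
          (∀ (x : ringClassField K ι m) (x' : ringClassField K ι (m * l)),
            (x : ℂ) = x' → d'.emb x' = d.emb x) →
        ∀ (v : HeightOneSpectrum (𝓞 K)), (l : 𝓞 K) ∈ v.asIdeal →
        ∀ (j : ℕ),
          (((p ^ j : ℕ) : ℤ) • d'.kolyvaginClass (Fact.out : p.Prime) M ∈
              (W.baseChange K).torsionLocalKer (v.adicCompletion K) ((p ^ M : ℕ) : ℤ) ↔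
            ((p ^ j : ℕ) : ℤ) • d.kolyvaginClass (Fact.out : p.Prime) M ∈
              (W.baseChange K).torsionLocalKer (v.adicCompletion K) ((p ^ M : ℕ) : ℤ)) := by
  intro W _ _ _ _ K _ _ hK hD3 hD4 hH p _ hp2 hirr hpN Dt β ι M hM m l hml hl hl2 hlm hK' d d' hσ hS hS' hemb v hv j
  have hp : p.Prime := Fact.out
  have hn0 : m * l ≠ 0 := hml.ne_zero
  have hln : l ∈ (m * l).primeFactors := Nat.mem_primeFactors.mpr ⟨hl, dvd_mul_left l m, hn0⟩
  have hml' : m * l / l = m := Nat.mul_div_cancel m hl.pos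
  have hpN' : p ∣ W.conductorNorm ℤ := Int.natCast_dvd_natCast.mp hpN
  have hD : NumberField.discr K < -4 := KolyvaginAssembly.discr_lt_neg_four hK ⟨hD3, hD4⟩
  have hcop : Nat.Coprime (m * l) (W.conductorNorm ℤ) :=
    (KolyvaginH37Bridge.coprime_of_forall_not_dvd hn0 fun q hq ↦ (hK' q hq).1.2.1).symm
  have hinert : (Ideal.span {(l : 𝓞 K)}).IsPrime := (hK' l hln).1.2.2.2.2.1
  haveI : ∀ k : ℕ, NumberField (ringClassField K ι k) := fun k ↦
    Summit.BirchSwinnertonDyer.Rank1Residual.JET.numberField_ringClassField K hK ι k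
  -- standing inputs of the two classes (irreducibility + `p` unramified in `K`; KolyCert)
  obtain ⟨hA', hPt'⟩ := isAdmissible_and_mem_invPoints_of_irreducible_of_heegner hK ι W hD3 hD4 hH hp2 hirr hpN'
    Dt β hml hK' d'
  have hKm : ∀ q ∈ m.primeFactors, Zhang2014.IsKolyvaginPrime (W.conductorNorm ℤ) W K p q ∧
      M ≤ Zhang2014.kolyvaginIndex W p q :=
    fun q hq ↦ hK' q (Nat.primeFactors_mono (dvd_mul_right m l) hn0 hq)
  obtain ⟨hA, hPt⟩ := isAdmissible_and_mem_invPoints_of_irreducible_of_heegner hK ι W hD3 hD4 hH hp2 hirr hpN'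
    Dt β (hml.squarefree_of_dvd (dvd_mul_right m l)) hKm d
  -- (γ) at the pair, from the published fact (`ℓ ≠ 2`)
  have hγ : ∀ [Fact l.Prime] (hΔ : ¬ (l : ℤ) ∣ minimalDiscriminantInt W)
      (φ₀ : absoluteGaloisGroup (ZMod l)), (∀ x : AlgebraicClosure (ZMod l), φ₀ • x = x ^ l) →
      ∀ (hle : ringClassField K ι m ≤ ringClassField K ι (m * l))
        (γ : ringClassField K ι (m * l) ≃ₐ[ℚ] ringClassField K ι (m * l)), γ ∈ ringClassGal ι (m * l) →
        geomReduction hΔ ((RatClosure.pointsEquiv (K := K) W).symm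
            (d'.toGeomPoints (pointGalHom W (ringClassField K ι (m * l)) γ d'.y))) =
          φ₀ • geomReduction hΔ ((RatClosure.pointsEquiv (K := K) W).symm
            (d'.toGeomPoints (pointGalHom W (ringClassField K ι (m * l)) γ
              (WeierstrassCurve.Affine.Point.map (W' := W)
                (letI : Algebra K ℂ := ι.toAlgebra; (RingClassField.inclusion ι hle).restrictScalars ℚ)
                d.y)))) := by
    -- transport the fact's corollary (data at `mℓ / ℓ`) to data at `m`
    have key : ∀ (m₀ : ℕ) (e : m * l / l = m₀) (d₀ : KolyvaginHeegnerData Dt β ι m₀) [Fact l.Prime]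
        (hΔ : ¬ (l : ℤ) ∣ minimalDiscriminantInt W)
        (φ₀ : absoluteGaloisGroup (ZMod l)), (∀ x : AlgebraicClosure (ZMod l), φ₀ • x = x ^ l) →
        ∀ (hle : ringClassField K ι m₀ ≤ ringClassField K ι (m * l))
          (γ : ringClassField K ι (m * l) ≃ₐ[ℚ] ringClassField K ι (m * l)),
          geomReduction hΔ ((RatClosure.pointsEquiv (K := K) W).symm
              (d'.toGeomPoints (pointGalHom W (ringClassField K ι (m * l)) γ d'.y))) =
            φ₀ • geomReduction hΔ ((RatClosure.pointsEquiv (K := K) W).symm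
              (d'.toGeomPoints (pointGalHom W (ringClassField K ι (m * l)) γ
                (WeierstrassCurve.Affine.Point.map (W' := W)
                  (letI : Algebra K ℂ := ι.toAlgebra; (RingClassField.inclusion ι hle).restrictScalars ℚ)
                  d₀.y)))) := by
      intro m₀ e
      subst e
      intro d₀ _ hΔ φ₀ hφ₀ hle γ
      exact h37.reductionCongruence rfl hK ⟨hD3, hD4⟩ hH hml hcop hln (Or.inl hl2) hinert d' d₀ hΔ hφ₀ hle γ
    intro _ hΔ φ₀ hφ₀ hle γ _
    exact key m hml' d hΔ φ₀ hφ₀ hle γ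
  -- the pair END (corner-p1 g10): `Sel_λ` for `c(d')` ↔ `Ker_λ` for `c(d)`
  have hpair := Prop44.zsmul_kolyvaginClass_mem_selmerLocalKer_iff_of_compat hK ι hD hH Dt hp hp2 hM hml hK' hln
    hml' d' d hσ hS hS' hemb hγ hA' hA hPt' hPt v hv j
  -- the (A)-half at the top (this seat g10)
  have hAtop := zsmul_kolyvaginClass_mem_selmerLocalKer_iff_mem_torsionLocalKer_of_irreducible_of_heegner hK ι W
    hD3 hD4 hH hp2 hirr hpN' Dt β hml hln hK' d' v hv ((p : ℤ) ^ j)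
  rw [show ((p ^ j : ℕ) : ℤ) = (p : ℤ) ^ j from Nat.cast_pow p j]
  exact hAtop.symm.trans hpair

end Summit.BirchSwinnertonDyer.BirchSwinnertonDyer.Theorems.JetchevIrreducibleProp44

end
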